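import Mathlib
import Literature.Analysis.FluidPDE.TypeIICoreWitness
import Literature.Analysis.FluidPDE.NSWave0
import Summits.NavierStokesRegularity.NavierStokesRegularity.Theorems.TypeIIInviscidRelaxationCoreExclusionAnchorObstructionEnergy
import HarnessLib

/-!
# Crux `MonopoleCoreExclusion` (stmt-1965): AXISYMMETRIC core witnesses at every level carry no energy either —
# the thin tube of `…CoreExclusionAnchorObstructionEnergy` is a witness of the class `IsAxisymmetric ∧ IsColumnar`

`--supports stmt-NavierStokesRegularity-1965` (helper file, negative side; theorems only, no definitions, no `sorry`;
outside the import cone of the route file).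

Companion of `CoreExclusionAnchorObstructionEnergy.exists_columnarWitness_energy_le` (p840902, stmt-1966).  The
registered anchor stub `stub_anchoredLateAxisymWitness` of line `axisymmetric_comparison_flow` (skeleton
`dd3458b3c2b350bd`) has the same residual (lateness + core-radius floor) as its columnar twin, certified non-kinematic
by the spoiler-shell families `MonopoleAnchorObstruction.exists_axisymWitnesses_never_late` (p832545) etc., all of
unbounded energy.  Here only the ENERGY statement is recorded for the axisymmetric class: the needle slice
`s⁻³·max(0, 1 - r(x)/s⁴) e_z` cut off outside `‖x‖ ≤ s/3` is invariant under rotations about its own axis, so it carries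
a level-`K` witness whose profile is BOTH axisymmetric and columnar, with energy `≤ (8/3)s³`:

* `isAxisymmetric_coneProfile_dilate` — the dilated cone profile `y ↦ max(0, 1 - r(c•y)) e_z` is axisymmetric;
* `exists_axisymColumnarWitness_energy_le` — ∀ `K > 0`, `ε > 0`: a level-`K` witness (viscosity `1`) of the class
  `IsAxisymmetric ∧ IsColumnar` with `∫ ‖u(t)‖² ≤ ε`;
* `exists_axisymWitness_energy_le` / `exists_axisymOrColumnarWitness_energy_le` — the classes of cruxes
  `MonopoleCoreExclusion` (stmt-1965) and `TypeIICoreRelaxation` (stmt-1963), by monotonicity in the class.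

So the witness predicate of all three core cruxes has no core-THICKNESS content and the Leray–Hopf energy bound cannot
interact with `hw` kinematically (the never-late AXISYMMETRIC family in the energy class would in addition need a thin
spoiler — not attempted here).  Nothing about Navier–Stokes regularity is claimed; no stub or crux is proved or refuted.
decomp-ns leaf hand 6-g28.
-/

noncomputable section

open Set Metric MeasureTheory Filter Topology
open Literature.Analysis.FluidPDE
open scoped ENNReal

namespace Summit.NavierStokesRegularity.NavierStokesRegularity.Theorems

-- the problem directory repeats the summit name (`NavierStokesRegularity/NavierStokesRegularity`)
set_option linter.dupNamespace false

namespace MonopoleCoreExclusionWitnessEnergy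

open CoreExclusionAnchorObstruction CoreExclusionAnchorObstructionFloor CoreExclusionAnchorObstructionEnergy

/-- The axial unit vector has norm one: `‖e_z‖ = 1` (file-local copy). [folklore] -/
private theorem norm_eZ : ‖(eZ : EuclideanSpace ℝ (Fin 3))‖ = 1 := by
  simp [eZ]

/-! ### The needle slice as an axisymmetric witness

The thin-tube slice is invariant under rotations about its own axis, so it is a witness of the class
`IsAxisymmetric ∧ IsColumnar` — hence of the class of crux `MonopoleCoreExclusion` (stmt-1965) and of the disjunctive
class of `TypeIICoreRelaxation` (stmt-1963) as well.  (For the axisymmetric ANCHOR obstruction a spoiler shell is needed,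
`MonopoleAnchorObstruction.mul_sub_one_lt_of_shellSpoiler`; only the energy statement is recorded here.) -/

/-- Rotations about the axis fix the multiples of `e_z` (file-local copy of
`MonopoleAnchorObstruction.rotZ_smul_eZ`). [folklore] -/
private theorem rotZ_smul_eZ' (θ c : ℝ) :
    rotZ θ (c • (eZ : EuclideanSpace ℝ (Fin 3))) = c • eZ := by
  ext i
  fin_cases i <;> simp [eZ]

/-- The dilated cone profile `y ↦ max(0, 1 - r(c • y)) e_z` is axisymmetric (its modulus depends on the cylindrical
radius only and it points along the axis). [folklore] -/
theorem isAxisymmetric_coneProfile_dilate (c : ℝ) :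
    IsAxisymmetric (fun y : EuclideanSpace ℝ (Fin 3) =>
      max 0 (1 - cylRadius (c • y)) • (eZ : EuclideanSpace ℝ (Fin 3))) := by
  intro θ y
  simp only [cylRadius_smul, cylRadius_rotZ, rotZ_smul_eZ']

/-- **A core witness of the class `IsAxisymmetric ∧ IsColumnar` at any level is compatible with arbitrarily small
energy.**  For every `K > 0` and `ε > 0` there are a field `u : ℝ → ℝ³ → ℝ³` and a time `t` such that `u t` carries a
level-`K` core witness at viscosity `1` whose profile is BOTH axisymmetric and columnar, while
`∫ ‖u(t,x)‖² dx ≤ ε`.  (The thin-tube slice `s⁻³·max(0, 1 - r(x)/s⁴) e_z` cut off outside `‖x‖ ≤ s/3`, with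
`s ≤ min(K, (4K)⁻¹)` and `(8/3)s³ ≤ ε`; witness centre `0`, `L = K s³`, `V = s⁻³`, frame `id`, profile
`y ↦ max(0, 1 - (K/s) r(y)) e_z`, exact closeness.) [folklore] -/
theorem exists_axisymColumnarWitness_energy_le (K ε : ℝ) (hK : 0 < K) (hε : 0 < ε) :
    ∃ (u : ℝ → EuclideanSpace ℝ (Fin 3) → EuclideanSpace ℝ (Fin 3)) (t : ℝ),
      TypeIICoreWitness (fun W => IsAxisymmetric W ∧ IsColumnar W) 1 K u t ∧
      ∫⁻ x, ‖u t x‖ₑ ^ 2 ≤ ENNReal.ofReal ε := by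
  -- the scale `s`
  set s : ℝ := min (min K (4 * K)⁻¹) (min 1 (3 / 8 * ε)) with hsdef
  have hs0 : 0 < s := lt_min (lt_min hK (by positivity)) (lt_min one_pos (by positivity))
  have hsK : s ≤ K := (min_le_left _ _).trans (min_le_left _ _)
  have hs4K : s ≤ (4 * K)⁻¹ := (min_le_left _ _).trans (min_le_right _ _)
  have hs1 : s ≤ 1 := (min_le_right _ _).trans (min_le_left _ _)
  have hsε : s ≤ 3 / 8 * ε := (min_le_right _ _).trans (min_le_right _ _)
  have hsK' : s * K ≤ 4⁻¹ := by
    calc s * K ≤ (4 * K)⁻¹ * K := mul_le_mul_of_nonneg_right hs4K hK.le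
      _ = 4⁻¹ := by field_simp
  -- the profile and the slice
  set G : EuclideanSpace ℝ (Fin 3) → EuclideanSpace ℝ (Fin 3) :=
    fun y => max 0 (1 - cylRadius y) • (eZ : EuclideanSpace ℝ (Fin 3)) with hG
  set f : EuclideanSpace ℝ (Fin 3) → EuclideanSpace ℝ (Fin 3) :=
    fun x => if ‖x‖ ≤ s / 3 then (s⁻¹ ^ 3) • G ((s ^ 4)⁻¹ • x) else 0 with hf
  have hGle : ∀ y, ‖G y‖ ≤ 1 := fun y => norm_coneProfile_le y
  have hG0 : G 0 = eZ := coneProfile_zero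
  have hGcol : IsColumnar G := isColumnar_coneProfile
  have hf0 : f 0 = (s⁻¹ ^ 3) • (eZ : EuclideanSpace ℝ (Fin 3)) := by
    have h : ‖(0 : EuclideanSpace ℝ (Fin 3))‖ ≤ s / 3 := by rw [norm_zero]; linarith
    simp only [hf, if_pos h, smul_zero, hG0]
  have hnorm0 : ‖f 0‖ = s⁻¹ ^ 3 := by
    rw [hf0, norm_smul, norm_eZ, mul_one, Real.norm_of_nonneg (by positivity)]
  have hbound : ∀ x, ‖f x‖ ≤ s⁻¹ ^ 3 := by
    intro x
    by_cases hx : ‖x‖ ≤ s / 3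
    · simp only [hf, if_pos hx]
      rw [norm_smul, Real.norm_of_nonneg (by positivity)]
      exact mul_le_of_le_one_right (by positivity) (hGle _)
    · simp only [hf, if_neg hx, norm_zero]
      positivity
  refine ⟨fun _ => f, 0, ?_, ?_⟩
  · -- the witness: centre `0`, `L = K s³`, `V = s⁻³`, frame `id`, profile `G ((K/s) •)`
    refine ⟨0, K * s ^ 3, s⁻¹ ^ 3, LinearIsometryEquiv.refl ℝ _, fun y => G ((K * s⁻¹) • y),
      by positivity, by positivity, ⟨isAxisymmetric_coneProfile_dilate _, ?_⟩, hbound, ?_, ?_, ?_, ?_⟩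
    · simpa using hGcol.rescale 0 (K * s⁻¹)
    · refine ⟨0, by rw [dist_self]; positivity, ?_⟩
      rw [hnorm0]; linarith [pow_pos (inv_pos.2 hs0) 3]
    · refine ⟨0, EuclideanSpace.single 0 1, by simp, by simp, ?_⟩
      have hc : (1 : ℝ) ≤ K * s⁻¹ := by
        rw [← div_eq_mul_inv, le_div_iff₀ hs0, one_mul]; exact hsK
      have hG1 : G ((K * s⁻¹) • EuclideanSpace.single 0 1) = 0 := coneProfile_smul_single_zero hc
      simp only [smul_zero]
      rw [hG0, hG1, sub_zero, norm_eZ]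
      norm_num
    · have h1 : K * s ^ 3 * s⁻¹ ^ 3 = K := by field_simp
      rw [mul_one, h1]
    · intro y hy
      have hy' : ‖(K * s ^ 3) • y‖ ≤ s / 3 := by
        rw [norm_smul, Real.norm_of_nonneg (by positivity)]
        have h1 : K * s ^ 3 * ‖y‖ ≤ K * s ^ 3 * K := mul_le_mul_of_nonneg_left hy (by positivity)
        have h2 : K * s ^ 3 * K = (s * K) ^ 2 * s := by ring
        have h3 : (s * K) ^ 2 ≤ (4⁻¹ : ℝ) ^ 2 := pow_le_pow_left₀ (by positivity) hsK' 2
        nlinarith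
      have hrefl : ∀ z : EuclideanSpace ℝ (Fin 3),
          (LinearIsometryEquiv.refl ℝ (EuclideanSpace ℝ (Fin 3))).symm z = z := fun z => rfl
      have hscal : (s ^ 4)⁻¹ * (K * s ^ 3) = K * s⁻¹ := by field_simp
      have hval : f ((0 : EuclideanSpace ℝ (Fin 3)) + (K * s ^ 3) • (LinearIsometryEquiv.refl ℝ _ y)) =
          (s⁻¹ ^ 3) • G ((K * s⁻¹) • y) := by
        simp only [LinearIsometryEquiv.coe_refl, id_eq, zero_add]
        simp only [hf, if_pos hy', smul_smul, hscal]
      beta_reduce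
      rw [hval, hrefl, smul_smul, inv_mul_cancel₀ (by positivity : s⁻¹ ^ 3 ≠ 0), one_smul, sub_self,
        norm_zero]
      positivity
  · -- the energy: speed² `s⁻⁶` on the box `[-s⁴, s⁴]² × [-s/3, s/3]`
    set c : Fin 3 → ℝ := ![s ^ 4, s ^ 4, s / 3] with hc
    set S : Set (EuclideanSpace ℝ (Fin 3)) :=
      (WithLp.ofLp : EuclideanSpace ℝ (Fin 3) → (Fin 3 → ℝ)) ⁻¹' Icc (-c) c with hS
    have htube : ∀ x, f x ≠ 0 → |x 0| ≤ s ^ 4 ∧ |x 1| ≤ s ^ 4 ∧ |x 2| ≤ s / 3 := by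
      intro x hx
      have hxn : ‖x‖ ≤ s / 3 := by
        by_contra h
        exact hx (by simp only [hf, if_neg h])
      have hGx : G ((s ^ 4)⁻¹ • x) ≠ 0 := by
        intro h0
        exact hx (by simp only [hf, if_pos hxn, h0, smul_zero])
      have hr : cylRadius ((s ^ 4)⁻¹ • x) < 1 := by
        by_contra h
        push Not at h
        exact hGx (by rw [hG]; simp only [max_eq_left (by linarith : 1 - cylRadius _ ≤ (0:ℝ)), zero_smul])
      rw [cylRadius_smul, abs_of_pos (by positivity)] at hr
      have hr' : cylRadius x < s ^ 4 := by
        have h4 : 0 < s ^ 4 := by positivity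
        have := mul_lt_mul_of_pos_left hr h4
        rwa [← mul_assoc, mul_inv_cancel₀ h4.ne', one_mul, mul_one] at this
      have hc0 : |x 0| ≤ cylRadius x := by
        rw [cylRadius, ← Real.sqrt_sq_eq_abs]
        exact Real.sqrt_le_sqrt (by nlinarith [sq_nonneg (x 1)])
      have hc1 : |x 1| ≤ cylRadius x := by
        rw [cylRadius, ← Real.sqrt_sq_eq_abs]
        exact Real.sqrt_le_sqrt (by nlinarith [sq_nonneg (x 0)])
      have hc2 : |x 2| ≤ ‖x‖ := by simpa using PiLp.norm_apply_le x 2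
      exact ⟨hc0.trans hr'.le, hc1.trans hr'.le, hc2.trans hxn⟩
    have hpt : ∀ x, ‖f x‖ₑ ^ 2 ≤ S.indicator (fun _ => ENNReal.ofReal (s⁻¹ ^ 3) ^ 2) x := by
      intro x
      by_cases hx : f x = 0
      · simp [hx]
      · obtain ⟨h0, h1, h2⟩ := htube x hx
        have hxS : x ∈ S := by
          rw [hS, mem_preimage, mem_Icc]
          refine ⟨fun i => ?_, fun i => ?_⟩ <;> fin_cases i <;>
            simp [hc, abs_le.1 h0, abs_le.1 h1, abs_le.1 h2]
        rw [indicator_of_mem hxS]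
        have h' : ‖f x‖ₑ ≤ ENNReal.ofReal (s⁻¹ ^ 3) := by
          rw [← ofReal_norm]
          exact ENNReal.ofReal_le_ofReal (hbound x)
        exact pow_le_pow_left' h' 2
    have h3 : s ^ 3 ≤ s := by
      have := pow_le_pow_of_le_one hs0.le hs1 (by norm_num : 1 ≤ 3)
      simpa using this
    calc ∫⁻ x, ‖f x‖ₑ ^ 2
        ≤ ∫⁻ x, S.indicator (fun _ => ENNReal.ofReal (s⁻¹ ^ 3) ^ 2) x := lintegral_mono hpt
      _ ≤ ENNReal.ofReal (s⁻¹ ^ 3) ^ 2 * volume S := lintegral_indicator_const_le _ _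
      _ = ENNReal.ofReal (s⁻¹ ^ 3) ^ 2 * (ENNReal.ofReal (s ^ 4 + s ^ 4) * ENNReal.ofReal (s ^ 4 + s ^ 4) *
            ENNReal.ofReal (s / 3 + s / 3)) := by
          rw [hS, volume_coordBox]
          simp [hc]
      _ = ENNReal.ofReal (8 / 3 * s ^ 3) := by
          rw [← ENNReal.ofReal_pow (by positivity), ← ENNReal.ofReal_mul (by positivity),
            ← ENNReal.ofReal_mul (by positivity), ← ENNReal.ofReal_mul (by positivity)]
          congr 1
          field_simp
          ring
      _ ≤ ENNReal.ofReal ε := ENNReal.ofReal_le_ofReal (by nlinarith)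

/-- **No energy lower bound follows from an AXISYMMETRIC core witness** (class of crux `MonopoleCoreExclusion`,
stmt-1965): for every `K > 0` and `ε > 0` some slice carries a level-`K` axisymmetric core witness at viscosity `1`
with `∫ ‖u(t,x)‖² dx ≤ ε`. [folklore] -/
theorem exists_axisymWitness_energy_le (K ε : ℝ) (hK : 0 < K) (hε : 0 < ε) :
    ∃ (u : ℝ → EuclideanSpace ℝ (Fin 3) → EuclideanSpace ℝ (Fin 3)) (t : ℝ),
      TypeIICoreWitness IsAxisymmetric 1 K u t ∧ ∫⁻ x, ‖u t x‖ₑ ^ 2 ≤ ENNReal.ofReal ε := by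
  obtain ⟨u, t, hw, hen⟩ := exists_axisymColumnarWitness_energy_le K ε hK hε
  exact ⟨u, t, hw.mono fun _ h => h.1, hen⟩

/-- **No energy lower bound follows from a witness of the disjunctive class** `IsAxisymmetric ∨ IsColumnar` (class of
crux `TypeIICoreRelaxation`, stmt-1963): for every `K > 0` and `ε > 0` some slice carries such a level-`K` witness at
viscosity `1` with `∫ ‖u(t,x)‖² dx ≤ ε`. [folklore] -/
theorem exists_axisymOrColumnarWitness_energy_le (K ε : ℝ) (hK : 0 < K) (hε : 0 < ε) :
    ∃ (u : ℝ → EuclideanSpace ℝ (Fin 3) → EuclideanSpace ℝ (Fin 3)) (t : ℝ),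
      TypeIICoreWitness (fun W => IsAxisymmetric W ∨ IsColumnar W) 1 K u t ∧
      ∫⁻ x, ‖u t x‖ₑ ^ 2 ≤ ENNReal.ofReal ε := by
  obtain ⟨u, t, hw, hen⟩ := exists_axisymColumnarWitness_energy_le K ε hK hε
  exact ⟨u, t, hw.mono fun _ h => Or.inl h.1, hen⟩

end MonopoleCoreExclusionWitnessEnergy

end Summit.NavierStokesRegularity.NavierStokesRegularity.Theorems

end
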